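import Mathlib.LinearAlgebra.UnitaryGroup
import Mathlib.Analysis.Complex.Basic
import Mathlib.Tactic.NoncommRing
import HarnessLib

/-!
# The involution extending a partial isometry whose image is orthogonal to its domain

Topic `Computability/QuantumComplexity` (a lever for typing printed quantum query algorithms in the
tree's model `QQueryAlg`, whose gates are elements of `Matrix.unitaryGroup`). Printed algorithms
routinely specify a round's unitary only on the vectors the algorithm can be in and leave the rest to
the reader:

> One can verify that such a unitary transformation exists by checking the inner products: for any
> `i ∈ [2m]`, `⟨i|U₂†U₂|i⟩ = … = 1`; for any `i, j ∈ [2m]`, `i ≠ j`, `⟨j|U₂†U₂|i⟩ = … = 0`.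
> (A. Ambainis, J. Iraids, J. Smotrovs, *Exact quantum query complexity of EXACT and THRESHOLD*,
> TQC 2013, §3, proof of Thm. 1; held text `paper:arxiv-1302.1235`, p. 5 L22–35)

> any unitary `T'` with `T'|0⟩ = u` will do (Boyer–Brassard–Høyer–Tapp, *Tight bounds on quantum
> searching*, §6; the rank-one case, realised in the tree by `QProg.householder`).

This file supplies the general finite-dimensional fact behind such sentences, as an EXPLICIT matrix:
given a finite set `D` of basis states and an orthonormal family of target vectors `w d` (`d ∈ D`)
each of which is orthogonal to every basis state of `D` (the image is orthogonal to the domain — the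
situation of every "write the outcome into a fresh register" step), the matrix

  `U = 1 − P_D − W Wᴴ + W + Wᴴ`,  `W = Σ_{d ∈ D} |w d⟩⟨e_d|`,  `P_D = Σ_{d ∈ D} |e_d⟩⟨e_d|`,

is a Hermitian involution (hence unitary) with `U e_d = w d`, `U (w d) = e_d` for `d ∈ D`, and
`U v = v` for every `v` orthogonal to all `e_d` and all `w d` (`invoGate_mem_unitaryGroup`,
`invoGate_mulVec_single`, `invoGate_mulVec_image`, `invoGate_mulVec_of_orthogonal`). The proof is the
algebra `WᴴW = P_D`, `P_D W = 0`, `W P_D = W`, `W W = 0`, whence with `Q = P_D + W Wᴴ`, `S = W + Wᴴ`: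
`Q² = Q`, `S² = Q`, `Q S = S Q = S`, and `U = (1 − Q) + S` squares to `1`.

No query-model object is used here; the file is imported by the typings of printed exact algorithms
(AIS13 Thm. 1 / Thm. 2) whose round unitaries are given on a subspace only.

## References

* A. Ambainis, J. Iraids, J. Smotrovs, *Exact quantum query complexity of EXACT and THRESHOLD*, TQC
  2013 (LIPIcs 22), arXiv:1302.1235, §3 (proof of Thm. 1, the inner-product check).
  [AmbainisIraidsSmotrovs2013]
* M. Boyer, G. Brassard, P. Høyer, A. Tapp, *Tight bounds on quantum searching*, Fortschr. Phys. 46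
  (1998), §6 ("any unitary `T'` with `T'|0⟩ = u` will do"). [BoyerEtAl1998]
-/

noncomputable section

open Matrix Finset

namespace Literature.Computability.QuantumComplexity.IsoGate

variable {ι : Type*} [Fintype ι] [DecidableEq ι]

/-! ### The data: domain projection and the partial isometry -/

/-- The projection `P_D = Σ_{d ∈ D} |e_d⟩⟨e_d|` onto the span of the basis states in `D`.
[cite: AmbainisIraidsSmotrovs2013, §3 (proof of Thm. 1)] -/
def projD (D : Finset ι) : Matrix ι ι ℂ := fun i j => if i = j ∧ j ∈ D then 1 else 0

/-- The partial isometry `W = Σ_{d ∈ D} |w d⟩⟨e_d|` with the prescribed columns `w d` on `D` and zero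
columns elsewhere. [cite: AmbainisIraidsSmotrovs2013, §3 (proof of Thm. 1)] -/
def isoW (D : Finset ι) (w : ι → ι → ℂ) : Matrix ι ι ℂ := fun i j => if j ∈ D then w j i else 0

/-- **The involution gate** `U = 1 − P_D − W Wᴴ + W + Wᴴ`. [cite: AmbainisIraidsSmotrovs2013, §3 (proof of Thm. 1)] -/
def invoGate (D : Finset ι) (w : ι → ι → ℂ) : Matrix ι ι ℂ :=
  1 - projD D - isoW D w * (isoW D w)ᴴ + isoW D w + (isoW D w)ᴴ

/-- The two hypotheses: the columns `w d`, `d ∈ D`, are orthonormal, and each is orthogonal to every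
basis state of `D`. [cite: AmbainisIraidsSmotrovs2013, §3 (proof of Thm. 1)] -/
structure IsAdmissible (D : Finset ι) (w : ι → ι → ℂ) : Prop where
  /-- `⟨w d, w d'⟩ = [d = d']` for `d, d' ∈ D`. -/
  orthonormal : ∀ d ∈ D, ∀ d' ∈ D, star (w d) ⬝ᵥ w d' = if d = d' then 1 else 0
  /-- `⟨e_{d'}, w d⟩ = 0` for `d, d' ∈ D`. -/
  perp : ∀ d ∈ D, ∀ d' ∈ D, w d d' = 0

variable {D : Finset ι} {w : ι → ι → ℂ}

/-! ### The four relations -/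

omit [Fintype ι] in
/-- `P_D` is Hermitian. [folklore] -/
private theorem projD_conjTranspose : (projD D)ᴴ = projD D := by
  ext i j
  simp only [conjTranspose_apply, projD]
  by_cases h : i = j
  · subst h; split_ifs <;> simp
  · rw [if_neg (fun hh => h hh.1.symm), if_neg (fun hh => h hh.1), star_zero]

/-- `P_D² = P_D`. [folklore] -/
private theorem projD_mul_projD : projD D * projD D = projD D := by
  ext i j
  simp only [mul_apply, projD]
  rw [Finset.sum_eq_single i]
  · by_cases h : i = j ∧ j ∈ D
    · obtain ⟨rfl, hj⟩ := h; simp [hj]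
    · rw [if_neg h]
      by_cases hi : i ∈ D
      · simp [hi]
      · simp [hi]
  · intro k _ hk; rw [if_neg (fun hh => hk hh.1.symm), zero_mul]
  · intro h; exact absurd (Finset.mem_univ i) h

/-- `Wᴴ W = P_D` (the columns are orthonormal). [cite: AmbainisIraidsSmotrovs2013, §3 (proof of Thm. 1)] -/
theorem conjTranspose_isoW_mul_isoW (h : IsAdmissible D w) :
    (isoW D w)ᴴ * isoW D w = projD D := by
  ext i j
  simp only [mul_apply, conjTranspose_apply, isoW, projD]
  by_cases hi : i ∈ D
  · by_cases hj : j ∈ D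
    · have hon := h.orthonormal i hi j hj
      simp only [dotProduct, Pi.star_apply] at hon
      simp only [hi, hj, if_true, and_true]
      rw [← hon]
    · have hij : ¬ (i = j ∧ j ∈ D) := fun hh => hj hh.2
      rw [if_neg hij]
      simp [hj]
  · have hij : ¬ (i = j ∧ j ∈ D) := fun hh => hi (hh.1 ▸ hh.2)
    rw [if_neg hij]
    simp [hi]

/-- `P_D W = 0` (the image is orthogonal to the domain). [cite: AmbainisIraidsSmotrovs2013, §3 (proof of Thm. 1)] -/
theorem projD_mul_isoW (h : IsAdmissible D w) : projD D * isoW D w = 0 := by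
  ext i j
  simp only [mul_apply, projD, isoW, Matrix.zero_apply]
  rw [Finset.sum_eq_single i]
  · by_cases hi : i ∈ D
    · by_cases hj : j ∈ D
      · simp [hi, hj, h.perp j hj i hi]
      · simp [hj]
    · simp [hi]
  · intro k _ hk; rw [if_neg (fun hh => hk hh.1.symm), zero_mul]
  · intro hh; exact absurd (Finset.mem_univ i) hh

/-- `W P_D = W` (the columns of `W` off `D` vanish). [folklore] -/
private theorem isoW_mul_projD : isoW D w * projD D = isoW D w := by
  ext i j
  simp only [mul_apply, projD, isoW]
  rw [Finset.sum_eq_single j]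
  · by_cases hj : j ∈ D <;> simp [hj]
  · intro k _ hk
    rw [if_neg (show ¬ (k = j ∧ j ∈ D) from fun hh => hk hh.1), mul_zero]
  · intro hh; exact absurd (Finset.mem_univ j) hh

/-- `W W = 0` (again because the image is orthogonal to the domain). [cite: AmbainisIraidsSmotrovs2013, §3 (proof of Thm. 1)] -/
theorem isoW_mul_isoW (h : IsAdmissible D w) : isoW D w * isoW D w = 0 := by
  ext i j
  simp only [mul_apply, isoW, Matrix.zero_apply]
  by_cases hj : j ∈ D
  · simp only [hj, if_true]
    refine Finset.sum_eq_zero fun k _ => ?_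
    by_cases hk : k ∈ D
    · rw [if_pos hk, h.perp j hj k hk, mul_zero]
    · rw [if_neg hk, zero_mul]
  · simp [hj]

/-! ### `Q = P_D + W Wᴴ` and `S = W + Wᴴ` -/

/-- `Wᴴ P_D = 0`. [folklore] -/
private theorem conjTranspose_isoW_mul_projD (h : IsAdmissible D w) :
    (isoW D w)ᴴ * projD D = 0 := by
  have := congrArg conjTranspose (projD_mul_isoW h)
  rwa [conjTranspose_mul, projD_conjTranspose, conjTranspose_zero] at this

/-- `P_D Wᴴ = Wᴴ`. [folklore] -/
private theorem projD_mul_conjTranspose_isoW : projD D * (isoW D w)ᴴ = (isoW D w)ᴴ := by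
  have := congrArg conjTranspose (isoW_mul_projD (D := D) (w := w))
  rwa [conjTranspose_mul, projD_conjTranspose] at this

/-- `Wᴴ Wᴴ = 0`. [folklore] -/
private theorem conjTranspose_isoW_mul_self (h : IsAdmissible D w) :
    (isoW D w)ᴴ * (isoW D w)ᴴ = 0 := by
  have := congrArg conjTranspose (isoW_mul_isoW h)
  rwa [conjTranspose_mul, conjTranspose_zero] at this

/-- `Q² = Q` for `Q = P_D + W Wᴴ`. [folklore] -/
private theorem q_mul_q (h : IsAdmissible D w) :
    (projD D + isoW D w * (isoW D w)ᴴ) * (projD D + isoW D w * (isoW D w)ᴴ) =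
      projD D + isoW D w * (isoW D w)ᴴ := by
  have h2 : projD D * (isoW D w * (isoW D w)ᴴ) = 0 := by
    rw [← Matrix.mul_assoc, projD_mul_isoW h, Matrix.zero_mul]
  have h3 : isoW D w * (isoW D w)ᴴ * projD D = 0 := by
    rw [Matrix.mul_assoc, conjTranspose_isoW_mul_projD h, Matrix.mul_zero]
  have h4 : isoW D w * (isoW D w)ᴴ * (isoW D w * (isoW D w)ᴴ) = isoW D w * (isoW D w)ᴴ := by
    rw [Matrix.mul_assoc, ← Matrix.mul_assoc ((isoW D w)ᴴ), conjTranspose_isoW_mul_isoW h,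
      ← Matrix.mul_assoc, isoW_mul_projD]
  calc (projD D + isoW D w * (isoW D w)ᴴ) * (projD D + isoW D w * (isoW D w)ᴴ)
      = projD D * projD D + projD D * (isoW D w * (isoW D w)ᴴ) + isoW D w * (isoW D w)ᴴ * projD D +
          isoW D w * (isoW D w)ᴴ * (isoW D w * (isoW D w)ᴴ) := by noncomm_ring
    _ = projD D + isoW D w * (isoW D w)ᴴ := by rw [projD_mul_projD, h2, h3, h4]; abel

/-- `S² = Q` for `S = W + Wᴴ`. [folklore] -/
private theorem s_mul_s (h : IsAdmissible D w) :
    (isoW D w + (isoW D w)ᴴ) * (isoW D w + (isoW D w)ᴴ) = projD D + isoW D w * (isoW D w)ᴴ := by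
  calc (isoW D w + (isoW D w)ᴴ) * (isoW D w + (isoW D w)ᴴ)
      = isoW D w * isoW D w + isoW D w * (isoW D w)ᴴ + (isoW D w)ᴴ * isoW D w +
          (isoW D w)ᴴ * (isoW D w)ᴴ := by noncomm_ring
    _ = projD D + isoW D w * (isoW D w)ᴴ := by
        rw [isoW_mul_isoW h, conjTranspose_isoW_mul_isoW h, conjTranspose_isoW_mul_self h]; abel

/-- `Q S = S`. [folklore] -/
private theorem q_mul_s (h : IsAdmissible D w) :
    (projD D + isoW D w * (isoW D w)ᴴ) * (isoW D w + (isoW D w)ᴴ) = isoW D w + (isoW D w)ᴴ := by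
  have h3 : isoW D w * (isoW D w)ᴴ * isoW D w = isoW D w := by
    rw [Matrix.mul_assoc, conjTranspose_isoW_mul_isoW h, isoW_mul_projD]
  have h4 : isoW D w * (isoW D w)ᴴ * (isoW D w)ᴴ = 0 := by
    rw [Matrix.mul_assoc, conjTranspose_isoW_mul_self h, Matrix.mul_zero]
  calc (projD D + isoW D w * (isoW D w)ᴴ) * (isoW D w + (isoW D w)ᴴ)
      = projD D * isoW D w + projD D * (isoW D w)ᴴ + isoW D w * (isoW D w)ᴴ * isoW D w +
          isoW D w * (isoW D w)ᴴ * (isoW D w)ᴴ := by noncomm_ring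
    _ = isoW D w + (isoW D w)ᴴ := by
        rw [projD_mul_isoW h, projD_mul_conjTranspose_isoW, h3, h4]; abel

/-- `S Q = S`. [folklore] -/
private theorem s_mul_q (h : IsAdmissible D w) :
    (isoW D w + (isoW D w)ᴴ) * (projD D + isoW D w * (isoW D w)ᴴ) = isoW D w + (isoW D w)ᴴ := by
  have h2 : isoW D w * (isoW D w * (isoW D w)ᴴ) = 0 := by
    rw [← Matrix.mul_assoc, isoW_mul_isoW h, Matrix.zero_mul]
  have h4 : (isoW D w)ᴴ * (isoW D w * (isoW D w)ᴴ) = (isoW D w)ᴴ := by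
    rw [← Matrix.mul_assoc, conjTranspose_isoW_mul_isoW h, projD_mul_conjTranspose_isoW]
  calc (isoW D w + (isoW D w)ᴴ) * (projD D + isoW D w * (isoW D w)ᴴ)
      = isoW D w * projD D + isoW D w * (isoW D w * (isoW D w)ᴴ) + (isoW D w)ᴴ * projD D +
          (isoW D w)ᴴ * (isoW D w * (isoW D w)ᴴ) := by noncomm_ring
    _ = isoW D w + (isoW D w)ᴴ := by
        rw [isoW_mul_projD, h2, conjTranspose_isoW_mul_projD h, h4]; abel

/-! ### The gate is a Hermitian involution, hence unitary -/

/-- `U = (1 − Q) + S`. [folklore] -/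
private theorem invoGate_eq : invoGate D w =
    (1 - (projD D + isoW D w * (isoW D w)ᴴ)) + (isoW D w + (isoW D w)ᴴ) := by
  unfold invoGate; abel

/-- `U` is Hermitian. [cite: AmbainisIraidsSmotrovs2013, §3 (proof of Thm. 1)] -/
theorem invoGate_conjTranspose : (invoGate D w)ᴴ = invoGate D w := by
  unfold invoGate
  rw [conjTranspose_add, conjTranspose_add, conjTranspose_sub, conjTranspose_sub, conjTranspose_one,
    projD_conjTranspose, conjTranspose_mul, conjTranspose_conjTranspose]
  abel

/-- `U² = 1`. [cite: AmbainisIraidsSmotrovs2013, §3 (proof of Thm. 1)] -/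
theorem invoGate_mul_invoGate (h : IsAdmissible D w) : invoGate D w * invoGate D w = 1 := by
  rw [invoGate_eq]
  calc (1 - (projD D + isoW D w * (isoW D w)ᴴ) + (isoW D w + (isoW D w)ᴴ)) *
        (1 - (projD D + isoW D w * (isoW D w)ᴴ) + (isoW D w + (isoW D w)ᴴ))
      = 1 - (projD D + isoW D w * (isoW D w)ᴴ) - (projD D + isoW D w * (isoW D w)ᴴ) +
          (projD D + isoW D w * (isoW D w)ᴴ) * (projD D + isoW D w * (isoW D w)ᴴ) +
          ((isoW D w + (isoW D w)ᴴ) - (projD D + isoW D w * (isoW D w)ᴴ) * (isoW D w + (isoW D w)ᴴ)) +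
          ((isoW D w + (isoW D w)ᴴ) - (isoW D w + (isoW D w)ᴴ) * (projD D + isoW D w * (isoW D w)ᴴ)) +
          (isoW D w + (isoW D w)ᴴ) * (isoW D w + (isoW D w)ᴴ) := by noncomm_ring
    _ = 1 := by rw [q_mul_q h, q_mul_s h, s_mul_q h, s_mul_s h]; abel

/-- **The involution gate is unitary.** [cite: AmbainisIraidsSmotrovs2013, §3 (proof of Thm. 1)] -/
theorem invoGate_mem_unitaryGroup (h : IsAdmissible D w) :
    invoGate D w ∈ Matrix.unitaryGroup ι ℂ := by
  rw [Matrix.mem_unitaryGroup_iff, star_eq_conjTranspose, invoGate_conjTranspose]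
  exact invoGate_mul_invoGate h

/-! ### Action: `e_d ↦ w d`, `w d ↦ e_d`, and the identity off `D ⊕ W(D)` -/

/-- `W e_d = w d` for `d ∈ D`. [folklore] -/
private theorem isoW_mulVec_single {d : ι} (hd : d ∈ D) :
    isoW D w *ᵥ Pi.single d 1 = w d := by
  funext i
  rw [mulVec_single_one]
  simp [isoW, hd]

/-- `Wᴴ e_d = 0` for `d ∈ D`. [folklore] -/
private theorem conjTranspose_isoW_mulVec_single (h : IsAdmissible D w) {d : ι} (hd : d ∈ D) :
    (isoW D w)ᴴ *ᵥ Pi.single d 1 = 0 := by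
  funext i
  rw [mulVec_single_one]
  simp only [col_apply, conjTranspose_apply, isoW, Pi.zero_apply]
  by_cases hi : i ∈ D
  · rw [if_pos hi, h.perp i hi d hd, star_zero]
  · rw [if_neg hi, star_zero]

/-- `P_D e_d = e_d` for `d ∈ D`. [folklore] -/
private theorem projD_mulVec_single {d : ι} (hd : d ∈ D) :
    projD D *ᵥ Pi.single d (1 : ℂ) = Pi.single d 1 := by
  funext i
  rw [mulVec_single_one]
  simp only [col_apply, projD]
  by_cases hi : i = d
  · subst hi; simp [hd]
  · rw [if_neg (fun hh => hi hh.1), Pi.single_eq_of_ne hi]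

/-- **`U e_d = w d`** for `d ∈ D`: the gate has the prescribed columns.
[cite: AmbainisIraidsSmotrovs2013, §3 (proof of Thm. 1)] -/
theorem invoGate_mulVec_single (h : IsAdmissible D w) {d : ι} (hd : d ∈ D) :
    invoGate D w *ᵥ Pi.single d 1 = w d := by
  unfold invoGate
  rw [add_mulVec, add_mulVec, sub_mulVec, sub_mulVec, Matrix.one_mulVec, projD_mulVec_single hd,
    ← mulVec_mulVec, conjTranspose_isoW_mulVec_single h hd, mulVec_zero, isoW_mulVec_single hd]
  simp

/-- **`U (w d) = e_d`** for `d ∈ D` (the gate is an involution). [cite: AmbainisIraidsSmotrovs2013, §3 (proof of Thm. 1)] -/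
theorem invoGate_mulVec_image (h : IsAdmissible D w) {d : ι} (hd : d ∈ D) :
    invoGate D w *ᵥ w d = Pi.single d 1 := by
  rw [← invoGate_mulVec_single h hd, mulVec_mulVec, invoGate_mul_invoGate h, Matrix.one_mulVec]

/-- **`U v = v`** for every `v` with no component on `D` and orthogonal to every `w d`: the gate does
nothing outside `span(D) ⊕ W(span(D))`. [cite: AmbainisIraidsSmotrovs2013, §3 (proof of Thm. 1)] -/
theorem invoGate_mulVec_of_orthogonal (v : ι → ℂ) (hvD : ∀ d ∈ D, v d = 0)
    (hvw : ∀ d ∈ D, star (w d) ⬝ᵥ v = 0) : invoGate D w *ᵥ v = v := by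
  have hP : projD D *ᵥ v = 0 := by
    funext i
    simp only [mulVec, dotProduct, projD, Pi.zero_apply]
    refine Finset.sum_eq_zero fun j _ => ?_
    by_cases hh : i = j ∧ j ∈ D
    · rw [if_pos hh, hvD j hh.2, mul_zero]
    · rw [if_neg hh, zero_mul]
  have hW : isoW D w *ᵥ v = 0 := by
    funext i
    simp only [mulVec, dotProduct, isoW, Pi.zero_apply]
    refine Finset.sum_eq_zero fun j _ => ?_
    by_cases hj : j ∈ D
    · rw [if_pos hj, hvD j hj, mul_zero]
    · rw [if_neg hj, zero_mul]
  have hWh : (isoW D w)ᴴ *ᵥ v = 0 := by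
    funext i
    simp only [mulVec, dotProduct, conjTranspose_apply, isoW, Pi.zero_apply]
    by_cases hi : i ∈ D
    · have := hvw i hi
      simp only [dotProduct, Pi.star_apply] at this
      simp only [hi, if_true]
      exact this
    · simp [hi]
  unfold invoGate
  rw [add_mulVec, add_mulVec, sub_mulVec, sub_mulVec, Matrix.one_mulVec, hP, ← mulVec_mulVec, hWh,
    mulVec_zero, hW]
  simp

/-- The involution gate as an element of the unitary group. [cite: AmbainisIraidsSmotrovs2013, §3 (proof of Thm. 1)] -/
def invoGateU (D : Finset ι) (w : ι → ι → ℂ) (h : IsAdmissible D w) : Matrix.unitaryGroup ι ℂ :=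
  ⟨invoGate D w, invoGate_mem_unitaryGroup h⟩

/-- Unfolding `invoGateU`. [cite: AmbainisIraidsSmotrovs2013, §3 (proof of Thm. 1)] -/
@[simp] theorem invoGateU_val (D : Finset ι) (w : ι → ι → ℂ) (h : IsAdmissible D w) :
    (invoGateU D w h : Matrix ι ι ℂ) = invoGate D w := rfl

end Literature.Computability.QuantumComplexity.IsoGate

end
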